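import Mathlib
import HarnessLib

/-!
# Quasi-finite morphisms: `𝔪_y 𝒪_{X,x}` is primary for the maximal ideal of `𝒪_{X,x}`
# (zero-dimensional fibres, read in the local rings; The Stacks Project 00PL / EGA IV₂ 6.1)

Topic `Literature/AlgebraicGeometry/Morphisms`; namespace `Literature.AlgebraicGeometry.Morphisms`.  THEOREMS ONLY.
Cell hodgecm-mathlib, fan B, row VI-5, package P1 (miracle flatness of the finite quotient), file P1b-2 of the plan
announced 2026-08-28T03:1xZ: the hypothesis «some power of `𝔪_x` lies in `𝔪_{f x} 𝒪_{X,x}`» of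
`Literature.AlgebraicGeometry.Morphisms.Flat.of_isRegularLocalRing_stalk` (file `FlatOfRegularStalks`) holds for every
LOCALLY QUASI-FINITE morphism with locally Noetherian source.

* `exists_maximalIdeal_pow_le_map_of_quasiFinite` — ring form: `R → S` quasi-finite (Mathlib `Algebra.QuasiFinite`),
  `S` Noetherian, `𝔮 ⊂ S` a prime over `𝔭 ⊂ R`, `A = R_𝔭`, `B = S_𝔮` (any localizations, `IsLocalization.AtPrime`)
  with compatible algebra structures: `𝔫_B ^ N ≤ 𝔪_A B` for some `N`.  Proof: a prime of `B` containing `𝔭B` is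
  `𝔮′B` for a prime `𝔮′ ⊆ 𝔮` of `S` over `𝔭`, and quasi-finiteness makes the fibre over `𝔭` discrete
  (`Algebra.QuasiFinite.eq_of_le_of_under_eq`), so `𝔮′ = 𝔮`: the radical of `𝔭B` is `𝔫_B`, which is finitely
  generated.
* `exists_maximalIdeal_pow_le_map_stalkMap` — scheme form: for `f : X ⟶ Y` locally quasi-finite with `X` locally
  Noetherian and `x ∈ X`, some power of `𝔪_x` lies in the extension of `𝔪_{f x}` along the stalk map
  `𝒪_{Y,f x} → 𝒪_{X,x}` (affine neighbourhoods `x ∈ V ⊆ f⁻¹U`; the stalks are the localizations of `Γ(Y,U) → Γ(X,V)`,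
  which is quasi-finite by `HasRingHomProperty`; Mathlib `IsAffineOpen.isLocalization_stalk`,
  `IsAffineOpen.comap_primeIdealOf_appLE`).

## References
* The Stacks Project, Tags 00PL (quasi-finite at a prime), 02NG.
* A. Grothendieck, EGA IV₂ (Publ. Math. IHÉS 24, 1965), §6.1; H. Matsumura, *Commutative Ring Theory*, §23
  (the fibre condition `dim B/𝔪_A B = 0` of Thm. 23.1).
-/

noncomputable section

open CategoryTheory AlgebraicGeometry IsLocalRing

universe u

namespace Literature.AlgebraicGeometry.Morphisms

/-! ### Ring form -/

/-- **The fibre of a quasi-finite algebra is zero-dimensional at every prime, read in the local rings**: for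
`R → S` quasi-finite with `S` Noetherian, a prime `𝔮` of `S` over `𝔭`, and localizations `A = R_𝔭`, `B = S_𝔮` with
compatible algebra structures, some power of the maximal ideal of `B` lies in `𝔪_A B` (equivalently `B/𝔪_A B` is
Artinian).  [cite: Matsumura1987, §23 (fibre condition of Thm. 23.1)] -/
theorem exists_maximalIdeal_pow_le_map_of_quasiFinite {R S A B : Type*} [CommRing R] [CommRing S]
    [Algebra R S] [Algebra.QuasiFinite R S] [IsNoetherianRing S]
    (p : Ideal R) [p.IsPrime] (q : Ideal S) [q.IsPrime] [q.LiesOver p]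
    [CommRing A] [Algebra R A] [IsLocalization.AtPrime A p] [IsLocalRing A]
    [CommRing B] [Algebra S B] [IsLocalization.AtPrime B q] [IsLocalRing B]
    [Algebra A B] [Algebra R B] [IsScalarTower R S B] [IsScalarTower R A B] :
    ∃ N : ℕ, maximalIdeal B ^ N ≤ (maximalIdeal A).map (algebraMap A B) := by
  haveI : IsNoetherianRing B := IsLocalization.isNoetherianRing q.primeCompl B inferInstance
  have hB : maximalIdeal B = q.map (algebraMap S B) :=
    (IsLocalization.AtPrime.map_eq_maximalIdeal q B).symm
  have hA : maximalIdeal A = p.map (algebraMap R A) :=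
    (IsLocalization.AtPrime.map_eq_maximalIdeal p A).symm
  have hJ : (maximalIdeal A).map (algebraMap A B) = p.map (algebraMap R B) := by
    rw [hA, Ideal.map_map, ← IsScalarTower.algebraMap_eq]
  rw [hJ]
  -- the radical of `𝔭B` is the maximal ideal of `B`
  have hle : maximalIdeal B ≤ (p.map (algebraMap R B)).radical := by
    rw [Ideal.radical_eq_sInf, le_sInf_iff]
    rintro P ⟨hP, hPprime⟩
    -- `P = 𝔮′B` with `𝔮′ = P ∩ S ⊆ 𝔮` a prime over `𝔭`
    let P' : Ideal S := P.comap (algebraMap S B)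
    haveI : P'.IsPrime := Ideal.IsPrime.comap (algebraMap S B)
    have hdisj := ((IsLocalization.isPrime_iff_isPrime_disjoint q.primeCompl B P).mp hPprime).2
    have hP'q : P' ≤ q := fun s hs => by
      by_contra hsq
      exact Set.disjoint_left.mp hdisj (show s ∈ (q.primeCompl : Set S) from hsq) hs
    have hunder : P'.under R = q.under R := by
      apply le_antisymm
      · exact fun r hr => Ideal.comap_mono (f := algebraMap R S) hP'q hr
      · intro r hr
        have hr' : r ∈ p := by rw [Ideal.LiesOver.over (P := q) (p := p)]; exact hr
        change algebraMap R S r ∈ P'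
        change algebraMap S B (algebraMap R S r) ∈ P
        rw [← IsScalarTower.algebraMap_apply]
        exact hP (Ideal.mem_map_of_mem _ hr')
    have hP'eq : P' = q := Algebra.QuasiFinite.eq_of_le_of_under_eq P' q hP'q hunder
    have hPeq : P = maximalIdeal B := by
      rw [hB, ← hP'eq, IsLocalization.map_under q.primeCompl B P]
    rw [hPeq]
  exact Ideal.exists_pow_le_of_le_radical_of_fg hle (IsNoetherian.noetherian _)

/-! ### Scheme form -/

/-- **For a locally quasi-finite morphism `f : X ⟶ Y` with `X` locally Noetherian, `𝔪_{f x} 𝒪_{X,x}` contains a power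
of `𝔪_x`** (the fibre of `f` through `x` is zero-dimensional at `x`): on affine neighbourhoods `x ∈ V ⊆ f⁻¹ U` the
stalk map is the localization at `x` of the quasi-finite ring map `Γ(Y, U) → Γ(X, V)`, and
`exists_maximalIdeal_pow_le_map_of_quasiFinite` applies. [cite: Matsumura1987, §23 (fibre condition of Thm. 23.1)] -/
theorem exists_maximalIdeal_pow_le_map_stalkMap {X Y : Scheme.{u}} (f : X ⟶ Y) [LocallyQuasiFinite f]
    [IsLocallyNoetherian X] (x : X) :
    ∃ N : ℕ, maximalIdeal (X.presheaf.stalk x) ^ N ≤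
      (maximalIdeal (Y.presheaf.stalk (f.base x))).map (f.stalkMap x).hom := by
  obtain ⟨U, hU, hfxU, -⟩ :=
    exists_isAffineOpen_mem_and_subset (X := Y) (x := f.base x) (U := ⊤) trivial
  obtain ⟨V, hV, hxV, hVU⟩ :=
    exists_isAffineOpen_mem_and_subset (X := X) (x := x) (U := f ⁻¹ᵁ U) hfxU
  -- the quasi-finite ring map `Γ(Y, U) → Γ(X, V)` and its localizations, the two stalks
  have hqf : (f.appLE U V hVU).hom.QuasiFinite := HasRingHomProperty.appLE @LocallyQuasiFinite f ‹_› ⟨U, hU⟩ ⟨V, hV⟩ hVU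
  letI : Algebra Γ(Y, U) Γ(X, V) := (f.appLE U V hVU).hom.toAlgebra
  haveI : Algebra.QuasiFinite Γ(Y, U) Γ(X, V) := hqf
  haveI : IsNoetherianRing Γ(X, V) := IsLocallyNoetherian.component_noetherian ⟨V, hV⟩
  letI := Y.presheaf.algebra_section_stalk (⟨f.base x, hVU hxV⟩ : U)
  haveI := hU.isLocalization_stalk ⟨f.base x, hVU hxV⟩
  letI := X.presheaf.algebra_section_stalk (⟨x, hxV⟩ : V)
  haveI := hV.isLocalization_stalk ⟨x, hxV⟩
  letI : Algebra (Y.presheaf.stalk (f.base x)) (X.presheaf.stalk x) := (f.stalkMap x).hom.toAlgebra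
  letI : Algebra Γ(Y, U) (X.presheaf.stalk x) :=
    ((X.presheaf.germ V x hxV).hom.comp (f.appLE U V hVU).hom).toAlgebra
  haveI : IsScalarTower Γ(Y, U) Γ(X, V) (X.presheaf.stalk x) := IsScalarTower.of_algebraMap_eq fun _ => rfl
  haveI : IsScalarTower Γ(Y, U) (Y.presheaf.stalk (f.base x)) (X.presheaf.stalk x) := by
    refine IsScalarTower.of_algebraMap_eq fun a => ?_
    simp only [RingHom.algebraMap_toAlgebra, Scheme.Hom.germ_stalkMap_apply, Scheme.Hom.appLE,
      homOfLE_leOfHom, CommRingCat.hom_comp, RingHom.coe_comp, Function.comp_apply,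
      X.presheaf.germ_res_apply]
  -- `𝔮 = 𝔭_x` lies over `𝔭 = 𝔭_{f x}`
  haveI : (hV.primeIdealOf ⟨x, hxV⟩).asIdeal.LiesOver (hU.primeIdealOf ⟨f.base x, hVU hxV⟩).asIdeal :=
    ⟨by
      rw [Ideal.under, RingHom.algebraMap_toAlgebra,
        ← congrArg PrimeSpectrum.asIdeal (IsAffineOpen.comap_primeIdealOf_appLE U hU V hV hVU hxV)]
      rfl⟩
  exact exists_maximalIdeal_pow_le_map_of_quasiFinite (hU.primeIdealOf ⟨f.base x, hVU hxV⟩).asIdeal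
    (hV.primeIdealOf ⟨x, hxV⟩).asIdeal

end Literature.AlgebraicGeometry.Morphisms

end
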